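import Summits.Ventures.Crystal3D.Theorems.StickyWulffConstantCoaxialWallLawWordMoves
import Summits.Ventures.Crystal3D.Theorems.StickyWulffConstantCoaxialWallLawEndRowDefs
import HarnessLib

/-!
# The word automaton at every version (v1/v2): the move map with the NARROW straight move is injective

HONEST FRAMING. Venture `Summits/Ventures/Crystal3D` (cell `crystal3d-full`), helper `--supports` the crux
`CoaxialWallLaw` of `route-Ventures-StickyWulffConstant` (REGISTERED line `WallLedgerF`).  Rung credit; F-C1 not
moved; no census.  cf-p1 g28 (xxxviii″)/(xxxviii⁗): the census key is `WordVersion.v2`, whose automaton has one more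
move, the NARROW straight move (`IsNarrow`, `…EndRowDefs`: target `b + d` and the positive triple of a menu normal
crossing `d` occupied).  This is `word_move_injOn` (`…WordMoves`) re-landed VERSION-PARAMETRIC, with the move clauses
in the typed vocabulary of `…EndRowDefs` (`IsFull`, `IsTwinReading`, `IsNarrow`, `IsMoving X ver (F κ) (d κ) b`):

* `word_move_injOn_gen` — the move map (FULL/GLIDE/NARROW: straight `(b + d κ, κ)`; CROSS along a twin reading
  `m` with `⟪d κ, m⟫ = √(2/3)`: `(b + d (next κ m), next κ m)`) is injective on the `ver`-moving states of a state
  set `V` whose states arrived along their own direction (`b − d κ ∈ X`).  The proof is the v1 proof: a straight and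
  a cross image never coincide (the straight pre-image would sit on the mirror image of a far slot of the twin
  dozen — `twinDozen_mirror_pos_notMem`, which uses only `b − d κ ∈ X`, not the kind of the straight move), and two
  cross images with the same mirror frame have the same normal (`twinDozen_normal_eq`).
* `not_isNarrow_of_twinReading_cross` — a state reading a twin dozen along a CROSSING normal is neither full nor
  narrow (its straight target is a far ball, absent): the move map is single-valued.
Only `1`-separation of `X` is used.  WHAT THIS IS NOT: targets, counting, exports are the next files; F-C1 not moved.
-/

noncomputable section

namespace Summit.Ventures.Crystal3D.Theorems

open Summit.Ventures.Crystal3D Finset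
open Literature.MathematicalPhysics.StatisticalMechanics (fccStacking)
open scoped InnerProductSpace

variable {X : Finset (EuclideanSpace ℝ (Fin 3))}

/-- **A crossing twin reading is neither full nor narrow**: the straight target `b + d` is a far ball of the twin
dozen, hence absent. -/
theorem not_mem_target_of_twinReading_cross (G : EuclideanSpace ℝ (Fin 3) ≃ₗᵢ[ℝ] EuclideanSpace ℝ (Fin 3))
    {m b d u : EuclideanSpace ℝ (Fin 3)} (htd : IsTwinReading X G m b) (hu : u ∈ fccSlots) (hdu : d = G u)
    (hdm : ⟪d, m⟫_ℝ = Real.sqrt (2 / 3)) : b + d ∉ X := by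
  have hr : 0 < Real.sqrt (2 / 3) := Real.sqrt_pos.2 (by norm_num)
  rw [hdu]
  exact htd.2.2.2 u hu (by rw [← hdu, hdm]; exact hr)

/-- A crossing twin reading is not a NARROW state (whatever the direction slot). -/
theorem not_isNarrow_of_twinReading_cross (G : EuclideanSpace ℝ (Fin 3) ≃ₗᵢ[ℝ] EuclideanSpace ℝ (Fin 3))
    {m b d u : EuclideanSpace ℝ (Fin 3)} (htd : IsTwinReading X G m b) (hu : u ∈ fccSlots) (hdu : d = G u)
    (hdm : ⟪d, m⟫_ℝ = Real.sqrt (2 / 3)) : ¬ IsNarrow X G d b :=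
  fun h => not_mem_target_of_twinReading_cross G htd hu hdu hdm h.1

/-- A crossing twin reading is not a FULL state. -/
theorem not_isFull_of_twinReading_cross (G : EuclideanSpace ℝ (Fin 3) ≃ₗᵢ[ℝ] EuclideanSpace ℝ (Fin 3))
    {m b d u : EuclideanSpace ℝ (Fin 3)} (htd : IsTwinReading X G m b) (hu : u ∈ fccSlots) (hdu : d = G u)
    (hdm : ⟪d, m⟫_ℝ = Real.sqrt (2 / 3)) : ¬ IsFull X G b :=
  fun h => not_mem_target_of_twinReading_cross G htd hu hdu hdm (by rw [hdu]; exact h u hu)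

section Moves

variable {K : Type*} {F : K → (EuclideanSpace ℝ (Fin 3) ≃ₗᵢ[ℝ] EuclideanSpace ℝ (Fin 3))}
  {d : K → EuclideanSpace ℝ (Fin 3)} {next : K → EuclideanSpace ℝ (Fin 3) → K}
  {V : Finset (EuclideanSpace ℝ (Fin 3) × K)}
  {f : EuclideanSpace ℝ (Fin 3) × K → EuclideanSpace ℝ (Fin 3) × K}

/-- **The move map of the word automaton is injective on the moving states — every version.**  See the module
docstring. -/
theorem word_move_injOn_gen (ver : WordVersion) (hX : ∀ p ∈ X, ∀ q ∈ X, p ≠ q → 1 ≤ dist p q)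
    (hd : ∀ κ, ∃ u ∈ fccSlots, d κ = F κ u)
    (hmirror : ∀ κ (m : EuclideanSpace ℝ (Fin 3)), ‖m‖ = 1 →
      (∀ w ∈ fccSlots, ⟪F κ w, m⟫_ℝ = 0 ∨ ⟪F κ w, m⟫_ℝ = Real.sqrt (2 / 3) ∨ ⟪F κ w, m⟫_ℝ = -Real.sqrt (2 / 3)) →
      ⟪d κ, m⟫_ℝ = Real.sqrt (2 / 3) → ∀ x, F (next κ m) x = F κ x - (2 * ⟪F κ x, m⟫_ℝ) • m)
    (hinv : ∀ κ (m : EuclideanSpace ℝ (Fin 3)), ‖m‖ = 1 →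
      (∀ w ∈ fccSlots, ⟪F κ w, m⟫_ℝ = 0 ∨ ⟪F κ w, m⟫_ℝ = Real.sqrt (2 / 3) ∨ ⟪F κ w, m⟫_ℝ = -Real.sqrt (2 / 3)) →
      ⟪d κ, m⟫_ℝ = Real.sqrt (2 / 3) → next (next κ m) m = κ)
    (hdnext : ∀ κ (m : EuclideanSpace ℝ (Fin 3)), ‖m‖ = 1 →
      (∀ w ∈ fccSlots, ⟪F κ w, m⟫_ℝ = 0 ∨ ⟪F κ w, m⟫_ℝ = Real.sqrt (2 / 3) ∨ ⟪F κ w, m⟫_ℝ = -Real.sqrt (2 / 3)) →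
      ⟪d κ, m⟫_ℝ = Real.sqrt (2 / 3) → ⟪d (next κ m), m⟫_ℝ = Real.sqrt (2 / 3))
    (hV : ∀ v ∈ V, v.1 - d v.2 ∈ X)
    (hf_full : ∀ v ∈ V, IsFull X (F v.2) v.1 → f v = (v.1 + d v.2, v.2))
    (hf_cross : ∀ v ∈ V, ∀ m : EuclideanSpace ℝ (Fin 3), IsTwinReading X (F v.2) m v.1 →
      ⟪d v.2, m⟫_ℝ = Real.sqrt (2 / 3) → f v = (v.1 + d (next v.2 m), next v.2 m))
    (hf_glide : ∀ v ∈ V, ∀ m : EuclideanSpace ℝ (Fin 3), IsTwinReading X (F v.2) m v.1 →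
      ⟪d v.2, m⟫_ℝ = 0 → f v = (v.1 + d v.2, v.2))
    (hf_narrow : ∀ v ∈ V, ver = WordVersion.v2 → IsNarrow X (F v.2) (d v.2) v.1 → f v = (v.1 + d v.2, v.2)) :
    Set.InjOn f {v | v ∈ V ∧ IsMoving X ver (F v.2) (d v.2) v.1} := by
  have hr : 0 < Real.sqrt (2 / 3) := Real.sqrt_pos.2 (by norm_num)
  -- the shape of the image of a moving state: STRAIGHT `(b + d κ, κ)` or CROSS along a reading `m`
  have hshape : ∀ v ∈ V, IsMoving X ver (F v.2) (d v.2) v.1 →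
      f v = (v.1 + d v.2, v.2) ∨
      ∃ m : EuclideanSpace ℝ (Fin 3), IsTwinReading X (F v.2) m v.1 ∧
        ⟪d v.2, m⟫_ℝ = Real.sqrt (2 / 3) ∧ f v = (v.1 + d (next v.2 m), next v.2 m) := by
    intro v hv hmv
    rcases hmv with hfull | ⟨m, htd, hdm⟩ | ⟨hver, hnar⟩
    · exact Or.inl (hf_full v hv hfull)
    · rcases hdm with hdm | hdm
      · exact Or.inr ⟨m, htd, hdm, hf_cross v hv m htd hdm⟩
      · exact Or.inl (hf_glide v hv m htd hdm)
    · exact Or.inl (hf_narrow v hv hver hnar)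
  -- a straight image and a cross image never coincide
  have hSC : ∀ v ∈ V, ∀ v' ∈ V, ∀ m : EuclideanSpace ℝ (Fin 3), IsTwinReading X (F v'.2) m v'.1 →
      ⟪d v'.2, m⟫_ℝ = Real.sqrt (2 / 3) →
      (v.1 + d v.2, v.2) ≠ (v'.1 + d (next v'.2 m), next v'.2 m) := by
    intro v hv v' hv' m htd' hdm' heq
    obtain ⟨⟨hm, hmenu'⟩, hown', -, -⟩ := htd'
    obtain ⟨h1, h2⟩ := Prod.mk.inj heq
    -- same class `κ = next κ' m`, hence same direction and same ball
    have hdd : d v.2 = d (next v'.2 m) := by rw [h2]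
    have hb : v.1 = v'.1 := by
      have := h1; rw [hdd] at this; exact add_right_cancel this
    -- `d κ = F κ u₀` with `⟪F κ' u₀, m⟫ = −√(2/3)`
    obtain ⟨u₀, hu₀, hdu⟩ := hd v.2
    have hFm := hmirror v'.2 m hm hmenu' hdm'
    have hdm : ⟪d v.2, m⟫_ℝ = Real.sqrt (2 / 3) := by rw [hdd]; exact hdnext v'.2 m hm hmenu' hdm'
    have hneg : ⟪F v'.2 u₀, m⟫_ℝ = -Real.sqrt (2 / 3) := by
      have h := hdm
      rw [hdu, h2, hFm, inner_sub_left, real_inner_smul_left, real_inner_self_eq_norm_sq, hm] at h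
      linarith
    -- so `b − d κ` is the mirror image of the positive slot `−u₀` of `F κ'` at the twin dozen `b`: absent
    have hpos : 0 < ⟪F v'.2 (-u₀), m⟫_ℝ := by rw [map_neg, inner_neg_left, hneg, neg_neg]; exact hr
    have key := twinDozen_mirror_pos_notMem hX (F v'.2) hm hmenu' hown' (neg_mem_fccSlots hu₀) hpos
    have hval := hV v hv
    rw [hb, hdu, h2, hFm] at hval
    have e : v'.1 + (F v'.2 (-u₀) - (2 * ⟪F v'.2 (-u₀), m⟫_ℝ) • m) =
        v'.1 - (F v'.2 u₀ - (2 * ⟪F v'.2 u₀, m⟫_ℝ) • m) := by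
      rw [map_neg, inner_neg_left]
      module
    exact key (by rw [e]; exact hval)
  rintro v ⟨hv, hmv⟩ v' ⟨hv', hmv'⟩ heq
  rcases hshape v hv hmv with hs | ⟨m, htd, hdm, hs⟩ <;>
    rcases hshape v' hv' hmv' with hs' | ⟨m', htd', hdm', hs'⟩
  · -- straight / straight
    rw [hs, hs'] at heq
    obtain ⟨h1, h2⟩ := Prod.mk.inj heq
    have hb : v.1 = v'.1 := by rw [h2] at h1; exact add_right_cancel h1
    exact Prod.ext hb h2
  · -- straight / cross
    rw [hs, hs'] at heq
    exact absurd heq (hSC v hv v' hv' m' htd' hdm')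
  · -- cross / straight
    rw [hs, hs'] at heq
    exact absurd heq.symm (hSC v' hv' v hv m htd hdm)
  · -- cross / cross: two readings of one ball with the same mirror frame
    rw [hs, hs'] at heq
    obtain ⟨⟨hm, hmenu⟩, hown, hmir, -⟩ := htd
    obtain ⟨⟨hm', hmenu'⟩, hown', hmir', -⟩ := htd'
    obtain ⟨h1, h2⟩ := Prod.mk.inj heq
    have hb : v.1 = v'.1 := by rw [h2] at h1; exact add_right_cancel h1
    have hF1 := hmirror v.2 m hm hmenu hdm
    have hF2 := hmirror v'.2 m' hm' hmenu' hdm'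
    have hmm : m = m' := by
      refine twinDozen_normal_eq hX (F (next v.2 m)) (F v.2) (F v'.2) hm hm' hmenu hmenu' hF1 ?_ hown ?_ ?_
      · intro x; rw [h2]; exact hF2 x
      · intro w hw h; rw [hb]; exact hown' w hw h
      · intro w hw h; rw [hb]; exact hmir' w hw h
    subst hmm
    have hκ : v.2 = v'.2 := by
      have e1 := hinv v.2 m hm hmenu hdm
      have e2 := hinv v'.2 m hm' hmenu' hdm'
      rw [← e1, h2, e2]
    exact Prod.ext hb hκ

end Moves

end Summit.Ventures.Crystal3D.Theorems

end
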